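import Summits.ABC.IUTFork.Conditional.AbcOfStatementGenuineK
import Summits.ABC.IUTFork.Conditional.AbcOfSlackRegimeSzpiro
import Summits.ABC.IUTFork.Conditional.AbcOfSHvolSzpiroSuff
import Summits.ABC.IUTFork.LDHGenuineHullRegimeMixedPoint
import Summits.ABC.ABC.Theorems.IUTThetaPilotThetaPartIIDegLe
import HarnessLib

/-!
# Branch C, K level — the DOWNSTREAM certificate `abc_of_cor312Statement_genuineK` (abc-iut-C-cert-2 p445044) with its CONE binder CUT:
# the degree-one cut (explicit 2 = [C312] · [READ], NO cone) and the three landed (P,l)-level cone currencies (hresSz / hSz / hMix)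

C scoreboard (R2 S-chain team, abc-iut-s2-p10 «float to TARGET #1»; PROOF-ONLY file: no `def`, no new `Prop`, no instance, no notation;
every hypothesis text is copied VERBATIM from the landed theorem it is fed to, every proof is a composition BY NAME). The K-level SYMMETRIC
RECORD of `Conditional/AbcOfStatementGenuineMCuts.lean` (abc-iut-s2-p10 p444732, the M-level cuts of abc-iut-C-cert-3's p443000); plan C-R23 (d)
ranks the K-level downstream twin a low-priority symmetric record (not cited in VERDICT v3.0), and so is this file.

abc-iut-C-cert-2's `Conditional.abc_of_cor312Statement_genuineK` (p445044) reads «`ABC` ⟸ [C312] `hst` + [READ] `hΘ` + [CONE] `hreg`»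
(explicit 3), where `hst` is the TYPED [IUTchIII] Cor. 3.12 `Cor312.Setting.Statement` (abc-iut-c312-7, DEFS-FROZEN) of the sharp
print-normalised genuine real setting `settingPrVolSharp (pilotDataOfK T.D T.K) …` over the `K`-LEVEL pilot datum of every ADMISSIBLE genuine
Θ-volume datum, FOR EVERY realising choice of pilot ideles (all choices give one setting: `Thm311.Real.settingPrVolSharp_pilotDataOfK_eq_chosen`,
p438766), `hΘ` is the ONE-SIDED Θ-volume identification `(setting).negLogTheta ≤ ↑T.negLogTheta` at the same data (the K-line's last READ
binder; its discharge = the Galois descent `Place K → V̲`, in flight: abc-iut-s2-p6 `Cor312ThetaSideClosedK` / abc-iut-s2-p7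
`Cor312ThetaSideSlotTransportK`; at the M-level settings it is the THEOREM `negLogTheta_settingMSharp_le_of_isVolumeInputOf`, abc-iut-s2-p8
p440655, which is why the M-twin p443000 / p444732 read one hypothesis fewer), and `hreg` is abc-iut-c312-8's hull-regime residue.

* §1 `vojta_degOne_of_cor312Statement_genuineK` — THE DEGREE-ONE CUT: p445044's data binders VERBATIM (as section variables) and its
  [C312] / [READ] binders with ONE extra guard `P.degree ≤ 1` each (strictly WEAKER), NOTHING ELSE ⟹ Vojta's height inequality with the
  printed `1+ε` for the degree-`1` points of every compactly bounded `K_V ∋ 2` ([IUTchIV] Cor. 2.2 (ii) / Cor. 2.3 at `d = 1`; the hull-volume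
  side is the THEOREM `ThetaPartIIDisplay.hullVolumeAtDatum_BIII_of_degree_le_one` inside `ThetaPartIIDisplay.vojtaIneq_two_degOne_of_cor312`).
  EXPLICIT 2 = C312 1 · READ 1 (CONE 0 · S/S_H 0 · PIN 0 · BRIDGE 0 · PROVENANCE 0 · SIDE 0 · FACT 0); READ ↦ 0 by instantiation once the
  K-descent lands.
* §2 `GenuineKStatement.cor312AtDatum_of_statement` — the [C312] + [READ] families (section hypotheses, p445044 VERBATIM) give
  `Cor22.Cor312AtDatum P l` (abc-iut-S2's Dupuy–Hilado inequality `T.Cor312Of` at every genuine Θ-volume datum) at every admissible `(P, l)`: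
  the `h312` slot of EVERY (U)-line capstone. Proof: p445044 §1 `GenuineK.cor312Of_of_statement` at the chosen realising ideles — the per-datum
  step of `abc_of_cor312Statement_genuineK`, isolated for re-use (hand it `(hΘ := …)` from the K-descent to drop READ everywhere below).
* §3 the three cone currencies, each «`ABC` ⟸ [C312] + [READ] per datum + ONE landed (P,l)-level cone input», explicit 3 = C312 · READ · CONE:
  `abc_of_cor312Statement_genuineK_szpiroSlack` (`hresSz`, `Conditional/AbcOfSlackRegimeSzpiro.lean` p436259 — the strongest landed cut,
  `hreg ⟹ habove ⟹ hresSz`), `…_szpiroSuff` (`hSz`, abc-iut-s2-p1 p435048's DATUM-FREE π-slack Szpiro-type inequality; its slack-free form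
  is REFUTED as a ∀-binder, abc-iut-s2-p5 `QuadWitness.not_szpiroPure` p442698), `…_pointMixedSzpiro` (`hMix`, abc-iut-s2-p1 p438083's
  datum-free mixed-height bound). Tails `ABC_of_cor312_of_szpiroSlackRegime` / `ABC_of_cor312_of_szpiroSuff` / `ABC_of_cor312_of_pointMixedSzpiro`
  BY NAME over §2. TARGET #1 of the R2 team ended CERTIFIED Szpiro-type (abc-iut-s2-p5 12:05Z; necessity sharpened datum-free by abc-iut-s2-p1
  p445083 and made admissibility-free by abc-iut-s2-p3 p443605 / p444275 / p444677), so these cuts only record the cone's price per currency.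

HONEST FRAMING: this campaign LOCATES / CONDITIONALLY VERIFIES. Nothing here asserts that abc (balanced or not) is proved or refuted, or that
[IUTchIII] Cor. 3.12 / Thm. 3.11 holds or fails at any datum, or takes a side on any author (Mochizuki / Scholze–Stix / Joshi / Dupuy–Hilado);
`hst` is an assumption label — the typed Cor. 3.12 at OUR genuine K-level settings, i.e. the adjudication's own object there (its hull-level
(xi-f) supplier S_H is refuted AS TYPED on this line, abc-iut-C-cert-1 `not_hSH_v6K` p443604 / abc-iut-C-cert-2 `not_hSH_v7K` p444075 —
«refuted as typed» ≠ «refuted in print»; `hst` itself is NOT refuted by depth); `hΘ` is an unproved identification at the K level;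
`hresSz` / `hSz` / `hMix` are unproved Szpiro-type inequalities. typed ≠ proved; instantiated ≠ endorsed. [claim: Mochizuki2012, status: disputed]
[cite: Mochizuki2012, IUTchIII Cor. 3.12 p. 173–174; IUTchIV Thm. 1.10 p. 22–31 (Step (v) p. 27–28), Cor. 2.2 (ii)–(iii) p. 43–47, Cor. 2.3 p. 54–55]
[cite: MochizukiGenEll2010, Thm. 2.1 p. 12] [cite: DupuyHilado2025, §3.3, §3.4, Thm. 3.10.1]
-/

noncomputable section

open Set Function NumberField IsDedekindDomain

namespace Summit.ABC.IUTFork.Conditional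

open Thm311 Thm311.Real Cor312 Cor312Vol Cor312Prov Literature.IUT.LogThetaLattice Literature.IUT.LogVolume
  Literature.IUT.HodgeTheaters Literature.IUT.LogVolume.ThetaData Literature.NumberTheory.NumberFields
open Literature.NumberTheory.DiophantineGeometry Literature.NumberTheory.DiophantineGeometry.GenEll Summit.ABC.ABC.Theorems

section Family

/-! ## §0. DATA of the family — p445044's context binders VERBATIM, as section variables: per `λ`-line point `P`, prime `l` and genuine
Θ-volume datum `T`, the context binders of abc-iut-c312-7's sharp print-normalised setting over the `K`-level pilot datum `pilotDataOfK T.D T.K`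
(abc-iut-C-cert-3; logs FIXED: analytic) — NO `qK`, NO `ρ`, NO idele / provenance binder (every realising choice is quantified INSIDE
`hst` / `hΘ`; the proofs instantiate at the chosen ideles `exists_realising_thetaIdeles_pilotDataOfK` / `…_qIdeles_…`, as p445044 does) -/

variable
    (M : ∀ (P : NFPoint) (l : ℕ) (T : Cor22.ThetaVolumeDatumAt P l), Type) [∀ P l T, Field (M P l T)] [∀ P l T, NumberField (M P l T)]
    (archPk : ∀ (P : NFPoint) (l : ℕ) (T : Cor22.ThetaVolumeDatumAt P l), letI := T.instFieldF; letI := T.instNumberFieldF; letI := T.instAlgebraF; letI := T.instFieldK;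
        letI := T.instNumberFieldK; letI := T.instAlgebraK; letI := T.instFieldFbar; letI := T.instAlgebraFbar;
        letI := T.instAlgebraKFbar; letI := T.instIsElliptic;
      ∀ (j : (thetaIndex (pilotDataOfK T.D T.K)).Label) (vQ : (thetaIndex (pilotDataOfK T.D T.K)).VQ), Set ((logShellsDH (pilotDataOfK T.D T.K) (analyticLogv T.K)).Packet j vQ))
    (archSub : ∀ (P : NFPoint) (l : ℕ) (T : Cor22.ThetaVolumeDatumAt P l), letI := T.instFieldF; letI := T.instNumberFieldF; letI := T.instAlgebraF; letI := T.instFieldK;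
        letI := T.instNumberFieldK; letI := T.instAlgebraK; letI := T.instFieldFbar; letI := T.instAlgebraFbar;
        letI := T.instAlgebraKFbar; letI := T.instIsElliptic;
      ∀ (j : (thetaIndex (pilotDataOfK T.D T.K)).Label) (v : (thetaIndex (pilotDataOfK T.D T.K)).V), Set ((logShellsDH (pilotDataOfK T.D T.K) (analyticLogv T.K)).Packet j ((thetaIndex (pilotDataOfK T.D T.K)).over v)))
    (Ψ : ∀ (P : NFPoint) (l : ℕ) (T : Cor22.ThetaVolumeDatumAt P l), letI := T.instFieldF; letI := T.instNumberFieldF; letI := T.instAlgebraF; letI := T.instFieldK;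
        letI := T.instNumberFieldK; letI := T.instAlgebraK; letI := T.instFieldFbar; letI := T.instAlgebraFbar;
        letI := T.instAlgebraKFbar; letI := T.instIsElliptic;
      ℤ → ∀ v : (thetaIndex (pilotDataOfK T.D T.K)).V, v ∈ (thetaIndex (pilotDataOfK T.D T.K)).Vbad → Set ((logShellsDH (pilotDataOfK T.D T.K) (analyticLogv T.K)).StarPacket v))
    (act : ∀ (P : NFPoint) (l : ℕ) (T : Cor22.ThetaVolumeDatumAt P l), letI := T.instFieldF; letI := T.instNumberFieldF; letI := T.instAlgebraF; letI := T.instFieldK;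
        letI := T.instNumberFieldK; letI := T.instAlgebraK; letI := T.instFieldFbar; letI := T.instAlgebraFbar;
        letI := T.instAlgebraKFbar; letI := T.instIsElliptic;
      ℤ → ∀ v : (thetaIndex (pilotDataOfK T.D T.K)).V, v ∈ (thetaIndex (pilotDataOfK T.D T.K)).Vbad → (logShellsDH (pilotDataOfK T.D T.K) (analyticLogv T.K)).StarPacket v → Module.End ℚ ((logShellsDH (pilotDataOfK T.D T.K) (analyticLogv T.K)).StarPacket v))
    (Mmod : ∀ (P : NFPoint) (l : ℕ) (T : Cor22.ThetaVolumeDatumAt P l), letI := T.instFieldF; letI := T.instNumberFieldF; letI := T.instAlgebraF; letI := T.instFieldK;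
        letI := T.instNumberFieldK; letI := T.instAlgebraK; letI := T.instFieldFbar; letI := T.instAlgebraFbar;
        letI := T.instAlgebraKFbar; letI := T.instIsElliptic;
      ℤ → ∀ j : (thetaIndex (pilotDataOfK T.D T.K)).LabelStar, Set ((logShellsDH (pilotDataOfK T.D T.K) (analyticLogv T.K)).GlobalPacket j.1))
    (region : ∀ (P : NFPoint) (l : ℕ) (T : Cor22.ThetaVolumeDatumAt P l), letI := T.instFieldF; letI := T.instNumberFieldF; letI := T.instAlgebraF; letI := T.instFieldK;
        letI := T.instNumberFieldK; letI := T.instAlgebraK; letI := T.instFieldFbar; letI := T.instAlgebraFbar;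
        letI := T.instAlgebraKFbar; letI := T.instIsElliptic;
      ℤ → ∀ j : (thetaIndex (pilotDataOfK T.D T.K)).LabelStar, FinDivisor (M P l T) → ∀ vQ : (thetaIndex (pilotDataOfK T.D T.K)).VQ, Set ((logShellsDH (pilotDataOfK T.D T.K) (analyticLogv T.K)).Packet j.1 vQ))
    (n : ∀ (P : NFPoint) (l : ℕ) (T : Cor22.ThetaVolumeDatumAt P l), ℤ)
    {HT : ∀ (P : NFPoint) (l : ℕ) (T : Cor22.ThetaVolumeDatumAt P l), Type} {LogLink : ∀ (P : NFPoint) (l : ℕ) (T : Cor22.ThetaVolumeDatumAt P l), HT P l T → HT P l T → Type}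
    {IsFull : ∀ (P : NFPoint) (l : ℕ) (T : Cor22.ThetaVolumeDatumAt P l), ∀ {s t : HT P l T}, LogLink P l T s t → Prop}
    (lat : ∀ (P : NFPoint) (l : ℕ) (T : Cor22.ThetaVolumeDatumAt P l), LGPGaussianLogThetaLattice (LogLink P l T) (IsFull P l T))
    {Frd : ∀ (P : NFPoint) (l : ℕ) (T : Cor22.ThetaVolumeDatumAt P l), Type} {IsoF : ∀ (P : NFPoint) (l : ℕ) (T : Cor22.ThetaVolumeDatumAt P l), Frd P l T → Frd P l T → Type} {Ob : ∀ (P : NFPoint) (l : ℕ) (T : Cor22.ThetaVolumeDatumAt P l), Frd P l T → Type}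
    {realify : ∀ (P : NFPoint) (l : ℕ) (T : Cor22.ThetaVolumeDatumAt P l), Frd P l T → Frd P l T} {Strip : ∀ (P : NFPoint) (l : ℕ) (T : Cor22.ThetaVolumeDatumAt P l), Type} {IsoS : ∀ (P : NFPoint) (l : ℕ) (T : Cor22.ThetaVolumeDatumAt P l), Strip P l T → Strip P l T → Type}
    {Mv : ∀ (P : NFPoint) (l : ℕ) (T : Cor22.ThetaVolumeDatumAt P l), letI := T.instFieldF; letI := T.instNumberFieldF; letI := T.instAlgebraF; letI := T.instFieldK;
        letI := T.instNumberFieldK; letI := T.instAlgebraK; letI := T.instFieldFbar; letI := T.instAlgebraFbar;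
        letI := T.instAlgebraKFbar; letI := T.instIsElliptic;
      ∀ v : (thetaIndex (pilotDataOfK T.D T.K)).V, v ∈ (thetaIndex (pilotDataOfK T.D T.K)).Vbad → Type}
    [∀ P l T v h, Monoid (Mv P l T v h)]
    (sig : ∀ (P : NFPoint) (l : ℕ) (T : Cor22.ThetaVolumeDatumAt P l), letI := T.instFieldF; letI := T.instNumberFieldF; letI := T.instAlgebraF; letI := T.instFieldK;
        letI := T.instNumberFieldK; letI := T.instAlgebraK; letI := T.instFieldFbar; letI := T.instAlgebraFbar;
        letI := T.instAlgebraKFbar; letI := T.instIsElliptic;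
      GlobalLGPFrobenioidSignature (thetaIndex (pilotDataOfK T.D T.K)).lstar (thetaIndex (pilotDataOfK T.D T.K)).V (· ∈ (thetaIndex (pilotDataOfK T.D T.K)).Vbad) (Frd P l T) (IsoF P l T) (Ob P l T) (realify P l T)
        (Strip P l T) (IsoS P l T) (Mv P l T))
    (split : ∀ (P : NFPoint) (l : ℕ) (T : Cor22.ThetaVolumeDatumAt P l), SplittingMonoids (Mv P l T))
    {ObΔ : ∀ (P : NFPoint) (l : ℕ) (T : Cor22.ThetaVolumeDatumAt P l), Type} {N : ∀ (P : NFPoint) (l : ℕ) (T : Cor22.ThetaVolumeDatumAt P l), letI := T.instFieldF; letI := T.instNumberFieldF; letI := T.instAlgebraF; letI := T.instFieldK;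
        letI := T.instNumberFieldK; letI := T.instAlgebraK; letI := T.instFieldFbar; letI := T.instAlgebraFbar;
        letI := T.instAlgebraKFbar; letI := T.instIsElliptic;
      ∀ v : (thetaIndex (pilotDataOfK T.D T.K)).V, v ∈ (thetaIndex (pilotDataOfK T.D T.K)).Vbad → Type}
    [∀ P l T v h, Monoid (N P l T v h)] (qData : ∀ (P : NFPoint) (l : ℕ) (T : Cor22.ThetaVolumeDatumAt P l), QPilotData (ObΔ P l T) (N P l T))

/-! ## §1. THE DEGREE-ONE CUT at the `K`-level: Vojta(`1+ε`) for the rational points of the `λ`-line on every `K_V ∋ 2` — explicit 2 = C312 1 · READ 1 -/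

/-- **`vojta_degOne_of_cor312Statement_genuineK` (K-level downstream certificate, DEGREE-ONE CUT; explicit 2 = [C312] 1 · [READ] 1 · CONE 0).**
Vojta's height inequality with the printed `1+ε` for the degree-`1` points of every compactly bounded `K_V` whose support contains `2`, from
p445044's data (sharp print-normalised setting over the K-level pilot datum of each datum, logs analytic, every realising choice of ideles)
and TWO hypotheses: [C312] `hst` — the TYPED [IUTchIII] Cor. 3.12 `Cor312.Setting.Statement` of that setting — and [READ] `hΘ` — the
one-sided Θ-volume identification — both demanded only at admissible RATIONAL points (`P ∈ U_P`, `P.degree ≤ 1`, `l` prime `≥ 5`,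
`AdmitsCore`, (P2), (P5), (P6)): p445044's binders with ONE extra guard, strictly weaker. NO hull-volume / CONE binder (a theorem at
`d_mod = 1`), no S / S_H / pin / bridge / provenance / side binder. K-twin of `vojta_degOne_of_cor312Statement_genuineM` (p444732, explicit 1:
there READ is abc-iut-s2-p8's theorem). «Vojta at degree 1 on `K_V ∋ 2` follows from the typed Cor. 3.12 + hΘ at these K-level settings, AS
TYPED» — no side taken on [IUTchIII] Cor. 3.12; typed ≠ proved; instantiated ≠ endorsed. [claim: Mochizuki2012, status: disputed] -/
theorem vojta_degOne_of_cor312Statement_genuineK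
    -- [C312] p445044's binder with ONE extra guard `P.degree ≤ 1` (admissible RATIONAL (P,l) only, every realising choice)
    (hst : ∀ (P : NFPoint), P ∈ UP → P.degree ≤ 1 → ∀ (l : ℕ), l.Prime → 5 ≤ l →
      Cor22.AdmitsCore P → Cor22.CondP2 P l → Cor22.CondP5 P l → Cor22.CondP6 P l →
      ∀ (T : Cor22.ThetaVolumeDatumAt P l), letI := T.instFieldF; letI := T.instNumberFieldF; letI := T.instAlgebraF; letI := T.instFieldK;
        letI := T.instNumberFieldK; letI := T.instAlgebraK; letI := T.instFieldFbar; letI := T.instAlgebraFbar;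
        letI := T.instAlgebraKFbar; letI := T.instIsElliptic;
      ∀ (tq : ∀ (pp : Nat.Primes) (x : (thetaIndex (pilotDataOfK T.D T.K)).Fibre (.inr pp)),
          haveI : Fact (pp : ℕ).Prime := ⟨pp.2⟩; kOf (pilotDataOfK T.D T.K) pp.1 x)
        (t : ∀ (pp : Nat.Primes) (_ : Fin (pilotDataOfK T.D T.K).lstar) (x : (thetaIndex (pilotDataOfK T.D T.K)).Fibre (.inr pp)),
          haveI : Fact (pp : ℕ).Prime := ⟨pp.2⟩; kOf (pilotDataOfK T.D T.K) pp.1 x)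
        (htq0 : ∀ pp x, tq pp x ≠ 0)
        (htq1 : ∀ (pp : Nat.Primes) (x : (thetaIndex (pilotDataOfK T.D T.K)).Fibre (.inr pp)),
          haveI : Fact (pp : ℕ).Prime := ⟨pp.2⟩; placeOf (pilotDataOfK T.D T.K) pp.1 x ∉ (pilotDataOfK T.D T.K).S → ‖tq pp x‖ = 1),
        (∀ pp i x, t pp i x ≠ 0) →
        (∀ (pp : Nat.Primes) (i : Fin (pilotDataOfK T.D T.K).lstar) (x : (thetaIndex (pilotDataOfK T.D T.K)).Fibre (.inr pp)),
          haveI : Fact (pp : ℕ).Prime := ⟨pp.2⟩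
          Real.log ‖t pp i x‖ = -((pilotDataOfK T.D T.K).thetaPilot i (placeOf (pilotDataOfK T.D T.K) pp.1 x)) *
            logNorm T.K (placeOf (pilotDataOfK T.D T.K) pp.1 x) / localDegree T.K (placeOf (pilotDataOfK T.D T.K) pp.1 x)) →
        (∀ (pp : Nat.Primes) (x : (thetaIndex (pilotDataOfK T.D T.K)).Fibre (.inr pp)),
          haveI : Fact (pp : ℕ).Prime := ⟨pp.2⟩
          Real.log ‖tq pp x‖ = -((pilotDataOfK T.D T.K).qPilot (placeOf (pilotDataOfK T.D T.K) pp.1 x)) *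
            logNorm T.K (placeOf (pilotDataOfK T.D T.K) pp.1 x) / localDegree T.K (placeOf (pilotDataOfK T.D T.K) pp.1 x)) →
      (settingPrVolSharp (pilotDataOfK T.D T.K) (logvAnalytic_analyticLogv (F := T.K)) (M P l T) (archPk P l T) (archSub P l T) (Ψ P l T)
          (act P l T) (Mmod P l T) (region P l T) (n P l T) (lat P l T) (sig P l T) (split P l T) (qData P l T)
          tq t htq0 htq1).Statement)
    -- [READ] p445044's one-sided Θ-identification with the same extra guard `P.degree ≤ 1`
    (hΘ : ∀ (P : NFPoint), P ∈ UP → P.degree ≤ 1 → ∀ (l : ℕ), l.Prime → 5 ≤ l →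
      Cor22.AdmitsCore P → Cor22.CondP2 P l → Cor22.CondP5 P l → Cor22.CondP6 P l →
      ∀ (T : Cor22.ThetaVolumeDatumAt P l), letI := T.instFieldF; letI := T.instNumberFieldF; letI := T.instAlgebraF; letI := T.instFieldK;
        letI := T.instNumberFieldK; letI := T.instAlgebraK; letI := T.instFieldFbar; letI := T.instAlgebraFbar;
        letI := T.instAlgebraKFbar; letI := T.instIsElliptic;
      ∀ (tq : ∀ (pp : Nat.Primes) (x : (thetaIndex (pilotDataOfK T.D T.K)).Fibre (.inr pp)),
          haveI : Fact (pp : ℕ).Prime := ⟨pp.2⟩; kOf (pilotDataOfK T.D T.K) pp.1 x)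
        (t : ∀ (pp : Nat.Primes) (_ : Fin (pilotDataOfK T.D T.K).lstar) (x : (thetaIndex (pilotDataOfK T.D T.K)).Fibre (.inr pp)),
          haveI : Fact (pp : ℕ).Prime := ⟨pp.2⟩; kOf (pilotDataOfK T.D T.K) pp.1 x)
        (htq0 : ∀ pp x, tq pp x ≠ 0)
        (htq1 : ∀ (pp : Nat.Primes) (x : (thetaIndex (pilotDataOfK T.D T.K)).Fibre (.inr pp)),
          haveI : Fact (pp : ℕ).Prime := ⟨pp.2⟩; placeOf (pilotDataOfK T.D T.K) pp.1 x ∉ (pilotDataOfK T.D T.K).S → ‖tq pp x‖ = 1),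
        (∀ pp i x, t pp i x ≠ 0) →
        (∀ (pp : Nat.Primes) (i : Fin (pilotDataOfK T.D T.K).lstar) (x : (thetaIndex (pilotDataOfK T.D T.K)).Fibre (.inr pp)),
          haveI : Fact (pp : ℕ).Prime := ⟨pp.2⟩
          Real.log ‖t pp i x‖ = -((pilotDataOfK T.D T.K).thetaPilot i (placeOf (pilotDataOfK T.D T.K) pp.1 x)) *
            logNorm T.K (placeOf (pilotDataOfK T.D T.K) pp.1 x) / localDegree T.K (placeOf (pilotDataOfK T.D T.K) pp.1 x)) →
        (∀ (pp : Nat.Primes) (x : (thetaIndex (pilotDataOfK T.D T.K)).Fibre (.inr pp)),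
          haveI : Fact (pp : ℕ).Prime := ⟨pp.2⟩
          Real.log ‖tq pp x‖ = -((pilotDataOfK T.D T.K).qPilot (placeOf (pilotDataOfK T.D T.K) pp.1 x)) *
            logNorm T.K (placeOf (pilotDataOfK T.D T.K) pp.1 x) / localDegree T.K (placeOf (pilotDataOfK T.D T.K) pp.1 x)) →
      (settingPrVolSharp (pilotDataOfK T.D T.K) (logvAnalytic_analyticLogv (F := T.K)) (M P l T) (archPk P l T) (archSub P l T) (Ψ P l T)
          (act P l T) (Mmod P l T) (region P l T) (n P l T) (lat P l T) (sig P l T) (split P l T) (qData P l T)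
          tq t htq0 htq1).negLogTheta ≤ ((T.negLogTheta : ℝ) : WithTop ℝ))
    -- [CONE] NONE (`d_mod = 1` at rational points) · [S]/[S_H] [PIN] [PROV] [BRIDGE] [ORBIT] [SIDE] [FACT] none (theorems inside)
    {ε : ℝ} (hε : 0 < ε) (D : CBData) (hD : D.SupportContains {2}) : VojtaIneq D.toSet 1 ε := by
  -- [IUTchIV] Cor 2.2 (ii) / 2.3 at d = 1 (abc-iut-S2's display; the volume side is a THEOREM at d_mod = 1) over p445044 §1 per datum,
  -- at the CHOSEN realising Θ-/q-ideles of the K-level pilot datum (immaterial: `settingPrVolSharp_pilotDataOfK_eq_chosen`, p438766)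
  refine ThetaPartIIDisplay.vojtaIneq_two_degOne_of_cor312 (fun P hP hdeg l hl h5 hc h2 h5' h6 T => ?_) hε D hD
  letI := T.instFieldF; letI := T.instNumberFieldF; letI := T.instAlgebraF; letI := T.instFieldK
  letI := T.instNumberFieldK; letI := T.instAlgebraK; letI := T.instFieldFbar; letI := T.instAlgebraFbar
  letI := T.instAlgebraKFbar; letI := T.instIsElliptic
  exact GenuineK.cor312Of_of_statement T.D T.K (M P l T) (archPk P l T) (archSub P l T) (Ψ P l T) (act P l T) (Mmod P l T)
    (region P l T) (n P l T) (lat P l T) (sig P l T) (split P l T) (qData P l T)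
    (exists_realising_thetaIdeles_pilotDataOfK T.D).choose (exists_realising_qIdeles_pilotDataOfK T.D).choose
    T.isVolumeInputOf (exists_realising_qIdeles_pilotDataOfK T.D).choose_spec.1 (exists_realising_qIdeles_pilotDataOfK T.D).choose_spec.2.1
    (exists_realising_qIdeles_pilotDataOfK T.D).choose_spec.2.2
    (hst P hP hdeg l hl h5 hc h2 h5' h6 T _ _ _ _ (exists_realising_thetaIdeles_pilotDataOfK T.D).choose_spec.1
      (exists_realising_thetaIdeles_pilotDataOfK T.D).choose_spec.2.2 (exists_realising_qIdeles_pilotDataOfK T.D).choose_spec.2.2)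
    (hΘ P hP hdeg l hl h5 hc h2 h5' h6 T _ _ _ _ (exists_realising_thetaIdeles_pilotDataOfK T.D).choose_spec.1
      (exists_realising_thetaIdeles_pilotDataOfK T.D).choose_spec.2.2 (exists_realising_qIdeles_pilotDataOfK T.D).choose_spec.2.2)

/-! ## §2. The [C312] and [READ] families of p445044 as section hypotheses (VERBATIM); the per-(P,l) brick -/

variable
    -- [C312] the TYPED Cor. 3.12 Statement of the sharp setting, for EVERY realising choice of pilot ideles, admissible data only
    (hst : ∀ (P : NFPoint), P ∈ UP → ∀ (l : ℕ), l.Prime → 5 ≤ l →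
      Cor22.AdmitsCore P → Cor22.CondP2 P l → Cor22.CondP5 P l → Cor22.CondP6 P l →
      ∀ (T : Cor22.ThetaVolumeDatumAt P l), letI := T.instFieldF; letI := T.instNumberFieldF; letI := T.instAlgebraF; letI := T.instFieldK;
        letI := T.instNumberFieldK; letI := T.instAlgebraK; letI := T.instFieldFbar; letI := T.instAlgebraFbar;
        letI := T.instAlgebraKFbar; letI := T.instIsElliptic;
      ∀ (tq : ∀ (pp : Nat.Primes) (x : (thetaIndex (pilotDataOfK T.D T.K)).Fibre (.inr pp)),
          haveI : Fact (pp : ℕ).Prime := ⟨pp.2⟩; kOf (pilotDataOfK T.D T.K) pp.1 x)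
        (t : ∀ (pp : Nat.Primes) (_ : Fin (pilotDataOfK T.D T.K).lstar) (x : (thetaIndex (pilotDataOfK T.D T.K)).Fibre (.inr pp)),
          haveI : Fact (pp : ℕ).Prime := ⟨pp.2⟩; kOf (pilotDataOfK T.D T.K) pp.1 x)
        (htq0 : ∀ pp x, tq pp x ≠ 0)
        (htq1 : ∀ (pp : Nat.Primes) (x : (thetaIndex (pilotDataOfK T.D T.K)).Fibre (.inr pp)),
          haveI : Fact (pp : ℕ).Prime := ⟨pp.2⟩; placeOf (pilotDataOfK T.D T.K) pp.1 x ∉ (pilotDataOfK T.D T.K).S → ‖tq pp x‖ = 1),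
        (∀ pp i x, t pp i x ≠ 0) →
        (∀ (pp : Nat.Primes) (i : Fin (pilotDataOfK T.D T.K).lstar) (x : (thetaIndex (pilotDataOfK T.D T.K)).Fibre (.inr pp)),
          haveI : Fact (pp : ℕ).Prime := ⟨pp.2⟩
          Real.log ‖t pp i x‖ = -((pilotDataOfK T.D T.K).thetaPilot i (placeOf (pilotDataOfK T.D T.K) pp.1 x)) *
            logNorm T.K (placeOf (pilotDataOfK T.D T.K) pp.1 x) / localDegree T.K (placeOf (pilotDataOfK T.D T.K) pp.1 x)) →
        (∀ (pp : Nat.Primes) (x : (thetaIndex (pilotDataOfK T.D T.K)).Fibre (.inr pp)),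
          haveI : Fact (pp : ℕ).Prime := ⟨pp.2⟩
          Real.log ‖tq pp x‖ = -((pilotDataOfK T.D T.K).qPilot (placeOf (pilotDataOfK T.D T.K) pp.1 x)) *
            logNorm T.K (placeOf (pilotDataOfK T.D T.K) pp.1 x) / localDegree T.K (placeOf (pilotDataOfK T.D T.K) pp.1 x)) →
      (settingPrVolSharp (pilotDataOfK T.D T.K) (logvAnalytic_analyticLogv (F := T.K)) (M P l T) (archPk P l T) (archSub P l T) (Ψ P l T)
          (act P l T) (Mmod P l T) (region P l T) (n P l T) (lat P l T) (sig P l T) (split P l T) (qData P l T)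
          tq t htq0 htq1).Statement)
    -- [READ] the ONE-SIDED Θ-side identification, for EVERY realising choice, admissible data only
    (hΘ : ∀ (P : NFPoint), P ∈ UP → ∀ (l : ℕ), l.Prime → 5 ≤ l →
      Cor22.AdmitsCore P → Cor22.CondP2 P l → Cor22.CondP5 P l → Cor22.CondP6 P l →
      ∀ (T : Cor22.ThetaVolumeDatumAt P l), letI := T.instFieldF; letI := T.instNumberFieldF; letI := T.instAlgebraF; letI := T.instFieldK;
        letI := T.instNumberFieldK; letI := T.instAlgebraK; letI := T.instFieldFbar; letI := T.instAlgebraFbar;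
        letI := T.instAlgebraKFbar; letI := T.instIsElliptic;
      ∀ (tq : ∀ (pp : Nat.Primes) (x : (thetaIndex (pilotDataOfK T.D T.K)).Fibre (.inr pp)),
          haveI : Fact (pp : ℕ).Prime := ⟨pp.2⟩; kOf (pilotDataOfK T.D T.K) pp.1 x)
        (t : ∀ (pp : Nat.Primes) (_ : Fin (pilotDataOfK T.D T.K).lstar) (x : (thetaIndex (pilotDataOfK T.D T.K)).Fibre (.inr pp)),
          haveI : Fact (pp : ℕ).Prime := ⟨pp.2⟩; kOf (pilotDataOfK T.D T.K) pp.1 x)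
        (htq0 : ∀ pp x, tq pp x ≠ 0)
        (htq1 : ∀ (pp : Nat.Primes) (x : (thetaIndex (pilotDataOfK T.D T.K)).Fibre (.inr pp)),
          haveI : Fact (pp : ℕ).Prime := ⟨pp.2⟩; placeOf (pilotDataOfK T.D T.K) pp.1 x ∉ (pilotDataOfK T.D T.K).S → ‖tq pp x‖ = 1),
        (∀ pp i x, t pp i x ≠ 0) →
        (∀ (pp : Nat.Primes) (i : Fin (pilotDataOfK T.D T.K).lstar) (x : (thetaIndex (pilotDataOfK T.D T.K)).Fibre (.inr pp)),
          haveI : Fact (pp : ℕ).Prime := ⟨pp.2⟩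
          Real.log ‖t pp i x‖ = -((pilotDataOfK T.D T.K).thetaPilot i (placeOf (pilotDataOfK T.D T.K) pp.1 x)) *
            logNorm T.K (placeOf (pilotDataOfK T.D T.K) pp.1 x) / localDegree T.K (placeOf (pilotDataOfK T.D T.K) pp.1 x)) →
        (∀ (pp : Nat.Primes) (x : (thetaIndex (pilotDataOfK T.D T.K)).Fibre (.inr pp)),
          haveI : Fact (pp : ℕ).Prime := ⟨pp.2⟩
          Real.log ‖tq pp x‖ = -((pilotDataOfK T.D T.K).qPilot (placeOf (pilotDataOfK T.D T.K) pp.1 x)) *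
            logNorm T.K (placeOf (pilotDataOfK T.D T.K) pp.1 x) / localDegree T.K (placeOf (pilotDataOfK T.D T.K) pp.1 x)) →
      (settingPrVolSharp (pilotDataOfK T.D T.K) (logvAnalytic_analyticLogv (F := T.K)) (M P l T) (archPk P l T) (archSub P l T) (Ψ P l T)
          (act P l T) (Mmod P l T) (region P l T) (n P l T) (lat P l T) (sig P l T) (split P l T) (qData P l T)
          tq t htq0 htq1).negLogTheta ≤ ((T.negLogTheta : ℝ) : WithTop ℝ))

include hst hΘ in
/-- **[C312] + [READ] families ⟹ `Cor22.Cor312AtDatum P l` at every ADMISSIBLE `(P, l)`** (`P ∈ UP`, `l` prime `≥ 5`, «admits an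
`F`-core», (P2), (P5), (P6)) — the `h312` slot of every (U)-line capstone (`ThetaPartII.ABC_of_cor312_of_hullRegime`, `…_of_slackRegime`,
`…_of_szpiroSlackRegime`, `…_of_szpiroSuff`, `ABC_of_cor312_of_pointMixedSzpiro`, `ThetaPartIIDisplay.vojtaIneq_two_degOne_of_cor312`), from
p445044's [C312] `hst` and [READ] `hΘ` section hypotheses VERBATIM (every realising choice of pilot ideles of `pilotDataOfK T.D T.K`).
Proof: p445044 §1 `GenuineK.cor312Of_of_statement` at `T.D`, `T.K`, `T.isVolumeInputOf` and the CHOSEN realising ideles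
(`exists_realising_thetaIdeles_pilotDataOfK` / `exists_realising_qIdeles_pilotDataOfK`, abc-iut-C-cert-3) — the per-datum step of
`abc_of_cor312Statement_genuineK`, isolated for re-use; supply `(hΘ := …)` from abc-iut-s2-p6/s2-p7's K-descent when it lands and READ is gone.
«Cor. 3.12's Dupuy–Hilado form at these data follows from the typed Cor. 3.12 + hΘ at these settings» — no side taken on [IUTchIII] Cor. 3.12;
`hst` / `hΘ` are assumption labels; typed ≠ proved; instantiated ≠ endorsed. [claim: Mochizuki2012, status: disputed] -/
theorem GenuineKStatement.cor312AtDatum_of_statement :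
    ∀ P : NFPoint, P ∈ UP → ∀ l : ℕ, l.Prime → 5 ≤ l →
      Cor22.AdmitsCore P → Cor22.CondP2 P l → Cor22.CondP5 P l → Cor22.CondP6 P l → Cor22.Cor312AtDatum P l := by
  intro P hP l hl h5 hc h2 h5' h6 T
  letI := T.instFieldF; letI := T.instNumberFieldF; letI := T.instAlgebraF; letI := T.instFieldK
  letI := T.instNumberFieldK; letI := T.instAlgebraK; letI := T.instFieldFbar; letI := T.instAlgebraFbar
  letI := T.instAlgebraKFbar; letI := T.instIsElliptic
  exact GenuineK.cor312Of_of_statement T.D T.K (M P l T) (archPk P l T) (archSub P l T) (Ψ P l T) (act P l T) (Mmod P l T)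
    (region P l T) (n P l T) (lat P l T) (sig P l T) (split P l T) (qData P l T)
    (exists_realising_thetaIdeles_pilotDataOfK T.D).choose (exists_realising_qIdeles_pilotDataOfK T.D).choose
    T.isVolumeInputOf (exists_realising_qIdeles_pilotDataOfK T.D).choose_spec.1 (exists_realising_qIdeles_pilotDataOfK T.D).choose_spec.2.1
    (exists_realising_qIdeles_pilotDataOfK T.D).choose_spec.2.2
    (hst P hP l hl h5 hc h2 h5' h6 T _ _ _ _ (exists_realising_thetaIdeles_pilotDataOfK T.D).choose_spec.1
      (exists_realising_thetaIdeles_pilotDataOfK T.D).choose_spec.2.2 (exists_realising_qIdeles_pilotDataOfK T.D).choose_spec.2.2)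
    (hΘ P hP l hl h5 hc h2 h5' h6 T _ _ _ _ (exists_realising_thetaIdeles_pilotDataOfK T.D).choose_spec.1
      (exists_realising_thetaIdeles_pilotDataOfK T.D).choose_spec.2.2 (exists_realising_qIdeles_pilotDataOfK T.D).choose_spec.2.2)

/-! ## §3. The cone currencies at the `K`-level: `ABC` from [C312] + [READ] per datum and ONE landed (P,l)-level cone input — explicit 3 each -/

include hst hΘ in
/-- **`abc_of_cor312Statement_genuineK_szpiroSlack`** — p445044 with the CONE binder CUT from `hreg` to `hresSz` of
`Conditional/AbcOfSlackRegimeSzpiro.lean` (abc-iut-s2-p10 p436259): the hull estimate with `B_III(P,l)` ONLY at non-slot-constant data of points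
with `2 ≤ d_mod` above abc-iut-c312-d1's explicit height threshold whose (Ind1) slot residue EXCEEDS abc-iut-s2-p1's Szpiro slack — the strongest
landed cut (`hreg ⟹ habove ⟹ hresSz`: `slackRegime_of_hullRegime`, `szpiroSlackRegime_of_slackRegime`); K-twin of
`abc_of_cor312Statement_genuineM_szpiroSlack` (p444732) and downstream twin of abc-iut-C-cert-2's `abc_of_SH_v7K_szpiroSlack` (p440821).
Explicit 3 = C312 1 + READ 1 + CONE 1. Proof: `ABC_of_cor312_of_szpiroSlackRegime` over §2. «`ABC` follows from the typed Cor. 3.12 + hΘ at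
these settings + hresSz, AS TYPED» — nothing asserted about any hypothesis; no side taken on [IUTchIII] Cor. 3.12; typed ≠ proved;
instantiated ≠ endorsed. [claim: Mochizuki2012, status: disputed] -/
theorem abc_of_cor312Statement_genuineK_szpiroSlack
    -- [CONE] `hresSz` = `Conditional/AbcOfSlackRegimeSzpiro.lean`'s Szpiro-slack residue cut, verbatim
    (hresSz : ∀ P : NFPoint, P ∈ UP → ∀ l : ℕ, l.Prime → 5 ≤ l →
      Cor22.AdmitsCore P → Cor22.CondP2 P l → Cor22.CondP5 P l → Cor22.CondP6 P l →
      2 ≤ Cor22.dmod P →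
      40 * Real.log (((2 ^ 12 * 3 ^ 3 * 5 * Cor22.dmod P : ℕ) : ℝ) * l)
        * ((Nat.primeCounting (2 ^ 12 * 3 ^ 3 * 5 * Cor22.dmod P * l) : ℝ)
          - (2 * (Cor22.dmod P : ℝ) * (P.logDiff + Cor22.logCondAvoid P {2, l}) + Real.log (2 * 3 * 5 * (l : ℝ)))
            / Real.log 2) < Cor22.logQAvoid P {2, l} →
      ∀ T : Cor22.ThetaVolumeDatumAt P l,
        (letI := T.instFieldF; letI := T.instNumberFieldF; letI := T.instAlgebraF; letI := T.instFieldK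
         letI := T.instNumberFieldK; letI := T.instAlgebraK; letI := T.instFieldFbar; letI := T.instAlgebraFbar
         letI := T.instAlgebraKFbar; letI := T.instIsElliptic
         ¬ (∀ p ∈ T.I.supportPrimes, ∀ v w : placesOver (fieldOfModuli T.E) p,
            (Summit.ABC.IUTFork.DHData.ofInput T.I).logQloc p v = (Summit.ABC.IUTFork.DHData.ofInput T.I).logQloc p w)) →
        (letI := T.instFieldF; letI := T.instNumberFieldF; letI := T.instFieldK; letI := T.instNumberFieldK
         letI := T.instAlgebraK
         ((l : ℝ) + 1) / 4 * (4 * ((Cor22.dmod P : ℝ) - 1) / l * (P.logDiff + Cor22.logCondAvoid P {2, l})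
            + 20 / 3 * Real.log (((2 ^ 12 * 3 ^ 3 * 5 * Cor22.dmod P : ℕ) : ℝ) * l)
              * ((Nat.primeCounting (2 ^ 12 * 3 ^ 3 * 5 * Cor22.dmod P * l) : ℝ)
                - ((T.I.supportPrimes.filter (· ≤ 2 ^ 12 * 3 ^ 3 * 5 * Cor22.dmod P * l)).card : ℝ))) <
           T.I.X.slotResidue T.I.supportPrimes) →
        T.HullEstimateOf
          (((l : ℝ) + 1) / 4 *
            ((1 + 12 * (Cor22.dmod P : ℝ) / l) * (P.logDiff + Cor22.logCondAvoid P {2, l})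
              + 2 * Real.log l + 52
              + 20 / 3 * Real.log (((2 ^ 12 * 3 ^ 3 * 5 * Cor22.dmod P : ℕ) : ℝ) * (l : ℝ))
                * (Nat.primeCounting (2 ^ 12 * 3 ^ 3 * 5 * Cor22.dmod P * l) : ℝ)))) :
    _root_.ABC :=
  ABC_of_cor312_of_szpiroSlackRegime (GenuineKStatement.cor312AtDatum_of_statement (hst := hst) (hΘ := hΘ)) hresSz

include hst hΘ in
/-- **`abc_of_cor312Statement_genuineK_szpiroSuff`** — p445044 with the CONE binder replaced by abc-iut-s2-p1's DATUM-FREE Szpiro-type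
inequality WITH π-SLACK at `d_mod ≥ 2` (`Conditional/AbcOfSHvolSzpiroSuff.lean` p435048, `hSz` verbatim; `d_mod = 1` is abc-iut-S3's pinned
theorem, inside) — the only admissible form of the Szpiro trade (the slack-free ∀-form is refuted over admissible data, abc-iut-s2-p5
`QuadWitness.not_szpiroPure` p442698). Explicit 3 = C312 1 + READ 1 + CONE 1, the cone input a statement about `λ` and `l` only. K-twin of
`abc_of_cor312Statement_genuineM_szpiroSuff` (p444732). Proof: `ABC_of_cor312_of_szpiroSuff` over §2. «`ABC` follows from the typed Cor. 3.12
+ hΘ at these settings + hSz, AS TYPED» — nothing asserted about any hypothesis; no side taken on [IUTchIII] Cor. 3.12; typed ≠ proved.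
[claim: Mochizuki2012, status: disputed] -/
theorem abc_of_cor312Statement_genuineK_szpiroSuff
    -- [CONE] abc-iut-s2-p1's datum-free Szpiro-type sufficient condition (π-slack form) at `d_mod ≥ 2`, verbatim
    (hSz : ∀ P : NFPoint, P ∈ UP → ∀ l : ℕ, l.Prime → 5 ≤ l →
      Cor22.AdmitsCore P → Cor22.CondP2 P l → Cor22.CondP5 P l → Cor22.CondP6 P l → 2 ≤ Cor22.dmod P →
      Cor22.logQAvoid P {2, l} ≤
        24 * ((Cor22.dmod P : ℝ) - 1) / l * (P.logDiff + Cor22.logCondAvoid P {2, l})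
        + 40 * Real.log (((2 ^ 12 * 3 ^ 3 * 5 * Cor22.dmod P : ℕ) : ℝ) * l)
          * max 0 (((Nat.primeCounting (2 ^ 12 * 3 ^ 3 * 5 * Cor22.dmod P * l) : ℝ)
            - (2 * (Cor22.dmod P : ℝ) * (P.logDiff + Cor22.logCondAvoid P {2, l}) + Real.log (2 * 3 * 5 * (l : ℝ)))
              / Real.log 2))) :
    _root_.ABC :=
  ABC_of_cor312_of_szpiroSuff (GenuineKStatement.cor312AtDatum_of_statement (hst := hst) (hΘ := hΘ)) hSz

open scoped Classical in
include hst hΘ in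
/-- **`abc_of_cor312Statement_genuineK_pointMixedSzpiro`** — p445044 with the CONE binder replaced by abc-iut-s2-p1's DATUM-FREE mixed-height
Szpiro-type bound `hMix` (`LDHGenuineHullRegimeMixedPoint.lean` p438083, TRADE 6 of the s2 SCOREBOARD; verbatim, same `Classical` decidability
context): at every admissible `(λ, l)` a finite set of primes containing the unequal-local-heights primes of `j(λ)` over `ℚ(j(λ))`, whose
weighted `{2,l}`-avoiding local heights are bounded by the Szpiro-max slack. Explicit 3 = C312 1 + READ 1 + CONE 1. K-twin of
`abc_of_cor312Statement_genuineM_pointMixedSzpiro` (p444732). Proof: `ABC_of_cor312_of_pointMixedSzpiro` over §2. «`ABC` follows from the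
typed Cor. 3.12 + hΘ at these settings + hMix, AS TYPED» — nothing asserted about any hypothesis; no side taken on [IUTchIII] Cor. 3.12;
typed ≠ proved; instantiated ≠ endorsed. [claim: Mochizuki2012, status: disputed] -/
theorem abc_of_cor312Statement_genuineK_pointMixedSzpiro
    -- [CONE] abc-iut-s2-p1's datum-free mixed-height Szpiro-type bound, verbatim
    (hMix : ∀ P : NFPoint, P ∈ UP → ∀ l : ℕ, l.Prime → 5 ≤ l →
      Cor22.AdmitsCore P → Cor22.CondP2 P l → Cor22.CondP5 P l → Cor22.CondP6 P l →
      ∃ M : Finset ℕ,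
        (∀ p : ℕ, p.Prime →
          (¬ ∀ V W : HeightOneSpectrum (𝓞 ↥(IntermediateField.adjoin ℚ ({Cor22.jInv P.x} : Set P.F))),
            V ∈ placesOver _ p → W ∈ placesOver _ p →
            (if ord _ V (Cor22.jMod P) < 0 ∧ ((2 : ℕ) : 𝓞 _) ∉ V.asIdeal ∧ ((l : ℕ) : 𝓞 _) ∉ V.asIdeal
              then ((-ord _ V (Cor22.jMod P) : ℤ) : ℝ) * logNorm _ V / (localDegree _ V : ℝ) else 0) =
            (if ord _ W (Cor22.jMod P) < 0 ∧ ((2 : ℕ) : 𝓞 _) ∉ W.asIdeal ∧ ((l : ℕ) : 𝓞 _) ∉ W.asIdeal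
              then ((-ord _ W (Cor22.jMod P) : ℤ) : ℝ) * logNorm _ W / (localDegree _ W : ℝ) else 0)) → p ∈ M) ∧
        ((l : ℝ) + 1) / 24 *
            ∑ p ∈ M, ∑ V : placesOver ↥(IntermediateField.adjoin ℚ ({Cor22.jInv P.x} : Set P.F)) p,
              (if ord _ V.1 (Cor22.jMod P) < 0 ∧ ((2 : ℕ) : 𝓞 _) ∉ V.1.asIdeal ∧ ((l : ℕ) : 𝓞 _) ∉ V.1.asIdeal then
                weight _ V.1 * (((-ord _ V.1 (Cor22.jMod P) : ℤ) : ℝ) * logNorm _ V.1 / (localDegree _ V.1 : ℝ))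
               else 0) ≤
          ((l : ℝ) + 1) / 4 * (4 * ((Cor22.dmod P : ℝ) - 1) / l * (P.logDiff + Cor22.logCondAvoid P {2, l})
            + 20 / 3 * Real.log (((2 ^ 12 * 3 ^ 3 * 5 * Cor22.dmod P : ℕ) : ℝ) * l)
              * max 0 (((Nat.primeCounting (2 ^ 12 * 3 ^ 3 * 5 * Cor22.dmod P * l) : ℝ)
                - (2 * (Cor22.dmod P : ℝ) * (P.logDiff + Cor22.logCondAvoid P {2, l}) + Real.log (2 * 3 * 5 * (l : ℝ)))
                  / Real.log 2)))) :
    _root_.ABC :=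
  ABC_of_cor312_of_pointMixedSzpiro (GenuineKStatement.cor312AtDatum_of_statement (hst := hst) (hΘ := hΘ)) hMix

end Family

end Summit.ABC.IUTFork.Conditional

end
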